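import Literature.MathematicalPhysics.StatisticalMechanics.HcpFccLatticeSums

/-!
# Certified hcp/fcc lattice sums: kernel-evaluated box floor sums (KernelA1)

Each theorem records the exact value of an integer box floor sum
`boxFloorSum 2 3 δ k R n 10^e = ∑_{|i|,|j| ≤ R} ⌊10^e / latticeNum 2 3 δ k i jⁿ⌋` (`c² = 2/3`; pattern
`δ`, layer `k`; `R = 40`, `n = 3`, `e = 18` resp. `R = 20`, `n = 6`, `e = 30`), evaluated by the
kernel (`decide +kernel`: structural recursion over the `(2R+1)²` shifted indices, GMP integer
arithmetic; no `native_decide`, standard axioms only).  The values were generated by `py/gen.py`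
from `py/boxsums_final.json` (item evidence) and are re-verified here by the kernel.  [folklore]
-/

namespace Literature.MathematicalPhysics.StatisticalMechanics.StackingSums

open Finset

/-- `boxFloorSum 2 3 0 2 40 3 10^18` (pattern `0`, layer `2`, exponent `3`). [folklore] -/
theorem boxFloorSum_3_0_2 : boxFloorSum 2 3 0 2 40 3 (10 ^ 18) = 350330028051448 := by
  decide +kernel

/-- `boxFloorSum 2 3 1 2 40 3 10^18` (pattern `1`, layer `2`, exponent `3`). [folklore] -/
theorem boxFloorSum_3_1_2 : boxFloorSum 2 3 1 2 40 3 (10 ^ 18) = 349659837972006 := by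
  decide +kernel

/-- `boxFloorSum 2 3 0 3 40 3 10^18` (pattern `0`, layer `3`, exponent `3`). [folklore] -/
theorem boxFloorSum_3_0_3 : boxFloorSum 2 3 0 3 40 3 (10 ^ 18) = 69112268688377 := by
  decide +kernel

/-- `boxFloorSum 2 3 1 3 40 3 10^18` (pattern `1`, layer `3`, exponent `3`). [folklore] -/
theorem boxFloorSum_3_1_3 : boxFloorSum 2 3 1 3 40 3 (10 ^ 18) = 69111648541010 := by
  decide +kernel

/-- `boxFloorSum 2 3 0 4 40 3 10^18` (pattern `0`, layer `4`, exponent `3`). [folklore] -/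
theorem boxFloorSum_3_0_4 : boxFloorSum 2 3 0 4 40 3 (10 ^ 18) = 21866705992794 := by
  decide +kernel

/-- `boxFloorSum 2 3 1 4 40 3 10^18` (pattern `1`, layer `4`, exponent `3`). [folklore] -/
theorem boxFloorSum_3_1_4 : boxFloorSum 2 3 1 4 40 3 (10 ^ 18) = 21866704369132 := by
  decide +kernel

/-- `boxFloorSum 2 3 0 8 40 3 10^18` (pattern `0`, layer `8`, exponent `3`). [folklore] -/
theorem boxFloorSum_3_0_8 : boxFloorSum 2 3 0 8 40 3 (10 ^ 18) = 1365727881195 := by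
  decide +kernel

/-- `boxFloorSum 2 3 1 8 40 3 10^18` (pattern `1`, layer `8`, exponent `3`). [folklore] -/
theorem boxFloorSum_3_1_8 : boxFloorSum 2 3 1 8 40 3 (10 ^ 18) = 1365727114834 := by
  decide +kernel

/-- `boxFloorSum 2 3 0 9 40 3 10^18` (pattern `0`, layer `9`, exponent `3`). [folklore] -/
theorem boxFloorSum_3_0_9 : boxFloorSum 2 3 0 9 40 3 (10 ^ 18) = 852254414014 := by
  decide +kernel

/-- `boxFloorSum 2 3 1 9 40 3 10^18` (pattern `1`, layer `9`, exponent `3`). [folklore] -/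
theorem boxFloorSum_3_1_9 : boxFloorSum 2 3 1 9 40 3 (10 ^ 18) = 852253670660 := by
  decide +kernel

/-- `boxFloorSum 2 3 0 10 40 3 10^18` (pattern `0`, layer `10`, exponent `3`). [folklore] -/
theorem boxFloorSum_3_0_10 : boxFloorSum 2 3 0 10 40 3 (10 ^ 18) = 558840121265 := by
  decide +kernel

/-- `boxFloorSum 2 3 1 10 40 3 10^18` (pattern `1`, layer `10`, exponent `3`). [folklore] -/
theorem boxFloorSum_3_1_10 : boxFloorSum 2 3 1 10 40 3 (10 ^ 18) = 558839402793 := by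
  decide +kernel


end Literature.MathematicalPhysics.StatisticalMechanics.StackingSums

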